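/-
Copyright (c) 2026. All rights reserved.
Released under Apache 2.0 license as described in the file LICENSE.
-/
import Summits.CriticalPhenomena.LaceExpansionHighD.NobleBlocksSharp
import Literature.Probability.FitznerVanDerHofstad2017.NobleBoundsNMidSOpen
import Literature.Probability.FitznerVanDerHofstad2017.NobleBoundsNFirstSOpen
import Literature.Probability.FitznerVanDerHofstad2017.NobleBoundsNLowStar
import HarnessLib
import Literature.Probability.FitznerVanDerHofstad2017.NobleBoundsNFirstECut
import Literature.Probability.FitznerVanDerHofstad2017.NobleBoundsNTargetsB
import Literature.Probability.FitznerVanDerHofstad2017.NobleBoundsNLowE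
import Literature.Probability.FitznerVanDerHofstad2017.NobleBoundsNResidualB
import Literature.Probability.FitznerVanDerHofstad2017.NobleBoundsNReal
import Literature.Probability.FitznerVanDerHofstad2017.NobleElementsClosedForms

/-!
# Fitzner–van der Hofstad (2017), Prop. 5.5 (5.34) at `N = M + 2` against the SHARP blocks, hypothesis-free — Part
II §A–§C: the corner cut-through (`R`: `z_k = t_k ∼ w_{k+1}`, `t_k ≠ u_{k+1}`): the event-level split of the line
`{w′ ←(≥1)→ t}`, the corner rows `A^{κ,a,2} + A^{κ,a,1}`, and the cut-through cell packages of a MIDDLE junction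
(bodies = `NobleBoundsNMidECut` verbatim except for the split third `A`-line) (WHAT-IF, DIVERGENCE D77; b2b-lace
LEMMAS node N76-X2-D77, module 5/11)

[FvdH17] = R. Fitzner, R. van der Hofstad, *Mean-field behavior for nearest-neighbor percolation in `d > 10`*,
arXiv:1506.07977v2 (EJP 22 (2017), paper 43).  Page numbers refer to the arXiv version.

SPLIT PROVENANCE: module 5 of 11 of the b2b-lace node N76-X2-D77 (what-if, DIVERGENCE D77) — the 11 modules are the
section-seam split (carver-g217, 2026-08-27) of the single-module form `NobleBoundsNSharpD77.lean` (carver-g51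
text-final, sha256 `877e12977f9f9c92`, 2707 lines): every declaration, statement and proof is carried over verbatim and
in the original order; only module boundaries, the repeated `section`/`variable` headers and two docstrings were added.
PLACEMENT: what-if objects of `NobleBlocksSharp` (b2b-lace LEAN PLACEMENT RULE, REFEREE R491), hence
`namespace Summit.CriticalPhenomena.LaceExpansionHighD.NobleBlocks`.  Conventions: `d`-generic; every declaration
carries its [FvdH17] display / page cite in the docstring; NOTHING is cited as a fact (b2b-lace ABSOLUTE RULE);
additive (no existing declaration is changed). -/

noncomputable section

namespace Summit.CriticalPhenomena.LaceExpansionHighD.NobleBlocks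

open Literature.Probability.FitznerVanDerHofstad2017 Literature.Probability.FitznerVanDerHofstad2017.NobleBlocks
open Literature.Probability.FitznerVanDerHofstad2017.NobleBlocks.LenIdx
open Literature.Probability.LatticeModels Literature.Probability.Percolation
open Literature.Probability.FitznerVanDerHofstad2017.BlockSummation
open Literature.Barriers.CriticalPhenomena
open Literature.Combinatorics.SimpleGraph _root_.SimpleGraph _root_.MeasureTheory
open scoped BigOperators ENNReal Matrix

variable {d : ℕ}

/-! ### A. The split of the line `{w′ ←1→ t}` -/

section Split

variable {V : Type*}

/-- **`{w′ ←1→ t} ⊆ {w′ ←2→ t} ∪ {w′ ←1̲→ t}`** (`w′ ≠ t`): a simple open path of length `≥ 1` from `w′` to `t` has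
length `≥ 2` or consists of the bond `(w′,t)`, which is then open.
[cite: FitznerVanDerHofstad2017, §4.2 (4.1) and "Modified two-point functions" (arXiv:1506.07977v2 p. 34); §6.1 "Case b = 1" / "b ≥ 2" (p. 59)] -/
theorem event_ge_one_subset_union {w' t : V} (hwt : w' ≠ t) :
    (event (ge 1) w' t : Set (BondConfig V)) ⊆ event (ge 2) w' t ∪ event (eq 1) w' t := by
  intro K hK
  rw [event_ge] at hK
  obtain ⟨q, hq, -⟩ := hK
  by_cases h2 : 2 ≤ q.length
  · exact Set.mem_union_left _ (by rw [event_ge]; exact ⟨q, hq, h2⟩)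
  · refine Set.mem_union_right _ ?_
    rw [event_eq, mem_openConnEq_one_iff]
    have h0 : q.length ≠ 0 := fun h => hwt (SimpleGraph.Walk.eq_of_length_eq_zero h)
    exact ⟨hwt, mem_of_mem_walk_edges q (mk_mem_edges_of_length_eq_one q (by omega))⟩

/-- Splitting the third of four lines along a union of two events splits the labelled disjoint-occurrence event.
[cite: FitznerVanDerHofstad2017, §4.2 Def. 4.1 (arXiv:1506.07977v2 p. 35)] -/
theorem genDisjOcc_four_subset_union {k : ℕ} (E₀ E₁ A B E₃ : Set (BondConfig V)) {E₂ : Set (BondConfig V)}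
    (h : E₂ ⊆ A ∪ B) (c : Fin 4 → Fin k) :
    genDisjOcc ![E₀, E₁, E₂, E₃] c ⊆ genDisjOcc ![E₀, E₁, A, E₃] c ∪ genDisjOcc ![E₀, E₁, B, E₃] c := by
  rintro ω ⟨K, hKω, hKA, hd⟩
  rcases h (hKA 2) with h2 | h2
  · exact Set.mem_union_left _ ⟨K, hKω, fun i => by fin_cases i; exacts [hKA 0, hKA 1, h2, hKA 3], hd⟩
  · exact Set.mem_union_right _ ⟨K, hKω, fun i => by fin_cases i; exacts [hKA 0, hKA 1, h2, hKA 3], hd⟩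

end Split

section SplitPerc

variable (p : unitInterval)

/-- The probability form: `ℙ_p^{⊗n}(⊛ four lines) ≤ ℙ_p^{⊗n}(⊛ … A …) + ℙ_p^{⊗n}(⊛ … B …)` when the third line's
event lies in `A ∪ B`. [cite: FitznerVanDerHofstad2017, §4.2 Def. 4.1, (4.18) (arXiv:1506.07977v2 p. 35)] -/
theorem piPerc_four_le_add {n : ℕ} (E₀ E₁ A B E₃ : Set (BondConfig (Site d))) {E₂ : Set (BondConfig (Site d))}
    (h : E₂ ⊆ A ∪ B) (c : Fin 4 → Fin n) :
    piPerc d p n (genDisjOcc ![E₀, E₁, E₂, E₃] c) ≤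
      piPerc d p n (genDisjOcc ![E₀, E₁, A, E₃] c) + piPerc d p n (genDisjOcc ![E₀, E₁, B, E₃] c) :=
  (measure_mono (genDisjOcc_four_subset_union E₀ E₁ A B E₃ h c)).trans (measure_union_le _ _)

end SplitPerc

/-! ### B. The corner rows: `A^{κ,a,2} + A^{κ,a,1}` -/

section Rows

variable (p : unitInterval)

/-- **Row `a ≥ 2` on the corner**: the lines `{u ←1̲→ v}`, `{v ↔ w′}`, `{w′ ←1→ t}`, `{t ↔ w}` (`w′ ≠ t`) are
bounded by `A^{ι,2,2}(u,w,w′,t) + A^{ι,2,1}(u,w,w′,t)`.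
[cite: FitznerVanDerHofstad2017, §6.1 "Cases a ≥ 1 and b ≥ 1" (arXiv:1506.07977v2 p. 59); App. B rows a ≥ 2, b ≥ 2 / b = 1 (p. 75)] -/
theorem piPerc_cutR_two_le {ι : Fin d × Bool} {u v w w' t : Site d} (hv : v = u + stepVec ι) (hwt : w' ≠ t)
    (c : Fin 4 → Fin 2) :
    piPerc d p 2 (genDisjOcc ![event (eq 1) u v, event (ge 0) v w', event (ge 1) w' t, event (ge 0) t w] c) ≤
      blockAiota (Letters.perc d p) ι 2 2 u w w' t + blockAiota (Letters.perc d p) ι 2 1 u w w' t :=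
  (piPerc_four_le_add p _ _ _ _ _ (event_ge_one_subset_union hwt) c).trans
    (add_le_add (piPerc_midF1_two_two_le_blockAiota p hv c) (piPerc_midF1_two_one_le_blockAiota p hv c))

/-- **Row `a = 1` on the corner**: for `(u,w)` a lattice bond the same four lines are bounded by
`A^{ι,1,2}(u,w,w′,t) + A^{ι,1,1}(u,w,w′,t)`.
[cite: FitznerVanDerHofstad2017, §6.1 "Case a = 1" (arXiv:1506.07977v2 p. 59); App. B rows a = 1, b ≥ 2 / b = 1 (p. 75)] -/
theorem piPerc_cutR_one_le {ι κ' : Fin d × Bool} {u v w w' t : Site d} (hv : v = u + stepVec ι)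
    (hw : w = u + stepVec κ') (hwt : w' ≠ t) (c : Fin 4 → Fin 2) :
    piPerc d p 2 (genDisjOcc ![event (eq 1) u v, event (ge 0) v w', event (ge 1) w' t, event (ge 0) t w] c) ≤
      blockAiota (Letters.perc d p) ι 1 2 u w w' t + blockAiota (Letters.perc d p) ι 1 1 u w w' t :=
  (piPerc_four_le_add p _ _ _ _ _ (event_ge_one_subset_union hwt) c).trans
    (add_le_add (piPerc_midF1_one_two_le_blockAiota p hv hw c) (piPerc_midF1_one_one_le_blockAiota p hv hw c))

/-- **Row `a = 0`, sub-row `x ≠ e`, on the corner**: for `w = u`, `w′ ≠ v` the lines `{u ←1̲→ v}`, `{v ←1→ w′}`,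
`{w′ ←1→ t}`, `{t ←1→ u}` (`t, w′ ≠ u`, `w′ ≠ t`) are bounded by `A^{ι,0,2}(u,u,w′,t) + A^{ι,0,1}(u,u,w′,t)`.
[cite: FitznerVanDerHofstad2017, §6.1 "Case a = 0" (arXiv:1506.07977v2 p. 58); App. B rows a = 0, b ≥ 2 / b = 1 (p. 75)] -/
theorem piPerc_cutR_zero_ne_le {ι : Fin d × Bool} {u v w' t : Site d} (hv : v = u + stepVec ι) (htu : t ≠ u)
    (hwu : w' ≠ u) (hwt : w' ≠ t) (c : Fin 4 → Fin 2) :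
    piPerc d p 2 (genDisjOcc ![event (eq 1) u v, event (ge 1) v w', event (ge 1) w' t, event (ge 1) t u] c) ≤
      blockAiota (Letters.perc d p) ι 0 2 u u w' t + blockAiota (Letters.perc d p) ι 0 1 u u w' t := by
  refine (piPerc_four_le_add p _ _ _ _ _ (event_ge_one_subset_union hwt) c).trans (add_le_add ?_ ?_)
  · refine (measure_mono (genDisjOcc_mono (fun i => ?_) c)).trans
      (piPerc_midF1_zero_two_le_blockAiota p hv htu hwu c)
    fin_cases i
    · exact subset_rfl
    · exact openConnGe_anti (Nat.zero_le 1) _ _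
    · exact subset_rfl
    · exact subset_rfl
  · exact piPerc_midF1_zero_one_ne_le_blockAiota p hv htu c

/-- **Row `a = 0`, sub-row `x = e`, on the corner**: for `w = u`, `w′ = v` the lines `{u ←1̲→ v}`, (`{v ↔ v}`),
`{v ←1→ t}`, `{t ←2→ u}` (`t ≠ u`, `v ≠ t`) are bounded by `A^{ι,0,2}(u,u,v,t) + A^{ι,0,1}(u,u,v,t)` (its summands
`S_{1̲,0,2,1}` and `δ_{x,e} T_{1̲,1̲,2}`).
[cite: FitznerVanDerHofstad2017, §6.1 "Case a = 0" (arXiv:1506.07977v2 p. 58); App. B rows a = 0, b ≥ 2 / b = 1 (p. 75)] -/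
theorem piPerc_cutR_zero_e_le {ι : Fin d × Bool} {u v t : Site d} (hv : v = u + stepVec ι) (htu : t ≠ u)
    (hvu : v ≠ u) (hvt : v ≠ t) (c : Fin 4 → Fin 2) :
    piPerc d p 2 (genDisjOcc ![event (eq 1) u v, event (ge 0) v v, event (ge 1) v t, event (ge 2) t u] c) ≤
      blockAiota (Letters.perc d p) ι 0 2 u u v t + blockAiota (Letters.perc d p) ι 0 1 u u v t := by
  refine (piPerc_four_le_add p _ _ _ _ _ (event_ge_one_subset_union hvt) c).trans (add_le_add ?_ ?_)
  · refine (measure_mono (genDisjOcc_mono (fun i => ?_) c)).trans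
      (piPerc_midF1_zero_two_le_blockAiota p hv htu hvu c)
    fin_cases i
    · exact subset_rfl
    · exact subset_rfl
    · exact subset_rfl
    · exact openConnGe_anti (Nat.le_succ 1) _ _
  · -- drop the trivial line `{v ↔ v}`: three lines, the triangle `T_{1̲,1̲,2}`
    refine (measure_mono ((genDisjOcc_subset_reindex ![(0 : Fin 4), 2, 3] (by decide) _ c).trans
      (Eq.subset ?_))).trans (piPerc_midF1_zero_one_e_le_blockAiota p hv htu fun i => c (![(0 : Fin 4), 2, 3] i))
    congr 1
    funext i
    fin_cases i <;> rfl

end Rows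

/-! ### C. MIDDLE junction: the corner cut-through packages -/

section Mid

variable (p : unitInterval) (M : ℕ) (x : Site d) (b : Fin (M + 2) → Site d × Site d) (w t z : Fin (M + 2) → Site d)
  (a : Fin (M + 2) → Fin 3 ⊕ Unit) (c : Fin 3 ⊕ Unit) (τ : Fin (M + 1) → Bool × Fin 3)

/-- **The cut-through cells `(a, ·, a′)` of a middle junction `k = i₀ + 1 ≤ M`, variant `F″` (`t_k ≠ u_{k+1}`), regime
`z_k = t_k`, ON the corner `w_{k+1} ~ t_k`**: a package with target
`(A^{κ,a,a′} + A^{κ,a,1})(u_k,w_k,w_{k+1},t_k) · P^{S,0}(u_{k+1} − t_k, u_{k+1} − t_k)`.  For `a′ ≤ 1` the piece is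
empty (clause (8)); for `a′ = 2` the leg `w_{k+1} → t_k` is an open simple path of length `≥ 1` (`w_{k+1} ≠ t_k`),
hence of length `≥ 2` (rows `(a, ≥2)`) or the open bond `(w_{k+1}, t_k)` (rows `(a,1)`); the `P^{S,0}`-letter is the
double connection `t_k ⇔ u_{k+1}` furnished by the two routes of the last sausage.
[cite: FitznerVanDerHofstad2017, §5.1 (5.4) second term (arXiv:1506.07977v2 p. 48); §6.1 (6.4), "Case a = 0", "Case a = 1", "b = 1", "b ≥ 2" (pp. 58–59); App. B (pp. 73, 75); §4.4 (4.58), (4.64) (pp. 41–42)] -/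
theorem nonempty_jPkg_midE_cutR (i i₀ : Fin (M + 1)) (hk : i₀.succ = i.castSucc) (κ : Fin d × Bool)
    (hb : (b i.castSucc).2 = (b i.castSucc).1 + stepVec κ) (hσ : (τ i).1 = true) (a₀ : Fin 3)
    (ha : a i.castSucc = Sum.inl a₀) {a' : Fin 3} (ha' : a i.succ = Sum.inl a')
    (hty : t i.castSucc ≠ (b i.succ).1) (hzt : z i.castSucc = t i.castSucc)
    (hadj : (zdGraph d).Adj (w i.succ) (t i.castSucc)) :
    Nonempty (JPkg p (jctx M x b w t z a τ i.castSucc) (JFacts M x b w t z a c τ)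
      ((blockAiota (Letters.perc d p) κ a₀ a' (b i.castSucc).1 (w i.castSucc) (w i.succ) (t i.castSucc) +
          blockAiota (Letters.perc d p) κ a₀ 1 (b i.castSucc).1 (w i.castSucc) (w i.succ) (t i.castSucc)) *
        blockPS (Letters.perc d p) 0 ((b i.succ).1 - t i.castSucc) ((b i.succ).1 - t i.castSucc))) := by
  -- exit class `a′ ≤ 1` above: the piece is empty (clause (8))
  by_cases h2 : a' = 2
  swap
  · exact nonempty_jPkg_of_sharp p c _ i hσ ha' h2 hty _
  subst h2
  -- degenerate parameters: the piece is empty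
  by_cases hP : (b i.castSucc).1 ≠ t i.castSucc ∧ (b i.castSucc).1 ≠ w i.succ ∧ (b i.castSucc).1 ≠ z i.castSucc ∧
      (b i.castSucc).2 ≠ z i.castSucc ∧ w i.succ ≠ t i.castSucc ∧
      (a₀ = 0 → w i.castSucc = (b i.castSucc).1) ∧ (a₀ = 1 → (zdGraph d).Adj (b i.castSucc).1 (w i.castSucc))
  swap
  · refine ⟨JPkg.vacuous p _ _ (fun ω K₀ hF => hP ?_) _⟩
    obtain ⟨-, -, hwt, hut, huw', huz, hvz, hw0, hw1⟩ := midECut_facts hF i i₀ hk hσ ha ha' hty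
    exact ⟨hut, huw', huz, hvz, hwt, hw0, hw1⟩
  obtain ⟨hut, huw', huz, hvz, hwt, hw0, hw1⟩ := hP
  -- the memberships shared by all rows
  have hm0 : ∀ ω K₀, JFacts M x b w t z a c τ ω K₀ →
      K₀ i.castSucc.succ 0 ∈ (event (ge 0) (b i.castSucc).2 (w i.succ) : Set (BondConfig (Site d))) ∧
        K₀ i.castSucc.succ 1 ∈ (event (ge 1) (w i.succ) (t i.castSucc) : Set (BondConfig (Site d))) ∧
        K₀ i.castSucc.succ 3 ∈ (event (ge 0) (t i.castSucc) (b i.succ).1 : Set (BondConfig (Site d))) ∧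
        K₀ i.castSucc.succ 4 ∈ (event (ge 0) (t i.castSucc) (b i.succ).1 : Set (BondConfig (Site d))) := by
    intro ω K₀ hF
    obtain ⟨h0, h1, -, h3, h4⟩ := hF.conn_midE i hσ ha'
    rw [hzt] at h4
    refine ⟨?_, ?_, ?_, ?_⟩
    · rw [event_ge]; exact mem_openConnGe_zero_of_mem h0
    · rw [event_ge]; exact mem_openConnGe_one_of_ne h1 hwt
    · rw [event_ge]; exact mem_openConnGe_zero_of_mem h3
    · rw [event_ge]; exact mem_openConnGe_zero_of_mem h4
  -- the `P^{S,0}` letter (two routes of the last sausage), shared by all rows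
  have hrow₂ : ∀ E0 E1 X5 : Set (BondConfig (Site d)),
      junF p M x b w t z a τ i.castSucc glMidS12 true false
        (midEv (event (eq 1) (b i.castSucc).1 (b i.castSucc).2) E0 E1 Set.univ
          (event (ge 0) (t i.castSucc) (b i.succ).1) (event (ge 0) (t i.castSucc) (b i.succ).1) X5) (.up 2) ≤
      blockPS (Letters.perc d p) 0 ((b i.succ).1 - t i.castSucc) ((b i.succ).1 - t i.castSucc) := by
    intro E0 E1 X5
    refine (junF_midECut_up_le₂ p M x b w t z a τ i hσ ha' _ _ _ _ _ _ _).trans ?_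
    rw [← blockPE_zero]
    exact piPerc_end_zero_le_blockPE p rfl _ rfl
  by_cases h0 : a₀ = 0
  · subst h0
    have hwu : w i.castSucc = (b i.castSucc).1 := hw0 rfl
    have huv : (zdGraph d).Adj (b i.castSucc).1 (b i.castSucc).2 := (zdGraph_adj_iff_stepVec _ _).2 ⟨κ, hb⟩
    by_cases hx : w i.succ = (b i.castSucc).2
    · -- row `a = 0`, sub-row `x = e`: the exit line `u_k → t_k` has length `≥ 2` by parity (`u ∼ v = w′ ∼ t`)
      have hna : ¬ (zdGraph d).Adj (b i.castSucc).1 (t i.castSucc) :=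
        not_adj_of_adj_adj huv (by rw [← hx]; exact hadj)
      refine nonempty_jPkg_midECut_core p M x b w t z a c τ i i₀ hk κ hb hσ ha ha'
        (event (ge 0) (b i.castSucc).2 (w i.succ)) (event (ge 1) (w i.succ) (t i.castSucc))
        (event (ge 0) (t i.castSucc) (b i.succ).1) (event (ge 0) (t i.castSucc) (b i.succ).1)
        (event (ge 2) (t i.castSucc) (b i.castSucc).1)
        (isFinitary_event _ _ _) (isFinitary_event _ _ _) (isFinitary_event _ _ _) (isFinitary_event _ _ _)
        (isFinitary_event _ _ _) (fun ω K₀ hF => ?_) ?_ (hrow₂ _ _ _)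
      · obtain ⟨m0, m1, m3, m4⟩ := hm0 ω K₀ hF
        refine ⟨m0, m1, m3, m4, ?_⟩
        have h5 := hF.conn_exit i i₀ hk ha
        rw [hzt, hwu] at h5
        rw [event_comm, event_ge]
        refine mem_openConnGe_two_of_notMem h5 hut fun hm => hna ?_
        exact (SimpleGraph.mem_edgeSet _).1 (hF.lattice _ (hF.witness_subset _ 5 hm))
      · refine (junF_midECut_xb_le₄ p M x b w t z a τ i i₀ hk hσ ha ha' _ _ _ _ _ _ _).trans ?_
        rw [hwu, hx]
        exact piPerc_cutR_zero_e_le p hb (fun h => hut h.symm) huv.ne.symm (fun h => hwt (hx.trans h)) _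
    · -- row `a = 0`, sub-row `x ≠ e`: the square
      refine nonempty_jPkg_midECut_core p M x b w t z a c τ i i₀ hk κ hb hσ ha ha'
        (event (ge 1) (b i.castSucc).2 (w i.succ)) (event (ge 1) (w i.succ) (t i.castSucc))
        (event (ge 0) (t i.castSucc) (b i.succ).1) (event (ge 0) (t i.castSucc) (b i.succ).1)
        (endX 0 (b i.castSucc).1 (w i.castSucc) (z i.castSucc))
        (isFinitary_event _ _ _) (isFinitary_event _ _ _) (isFinitary_event _ _ _) (isFinitary_event _ _ _)
        (isFinitary_endX _ _ _ _) (fun ω K₀ hF => ?_) ?_ (hrow₂ _ _ _)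
      · obtain ⟨-, m1, m3, m4⟩ := hm0 ω K₀ hF
        obtain ⟨h0', -⟩ := hF.conn_midE i hσ ha'
        refine ⟨?_, m1, m3, m4, midSOpen_exit_mem M x b w t z a c τ hF i i₀ hk ha huz hw0⟩
        rw [event_ge]; exact mem_openConnGe_one_of_ne h0' fun h => hx h.symm
      · refine (junF_midECut_xb_le₄ p M x b w t z a τ i i₀ hk hσ ha ha' _ _ _ _ _ _ _).trans ?_
        rw [hzt, endX, if_pos rfl, hwu]
        exact piPerc_cutR_zero_ne_le p hb (fun h => hut h.symm) (fun h => huw' h.symm) hwt _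
  · -- rows `a = 1`, `a ≥ 2`
    refine nonempty_jPkg_midECut_core p M x b w t z a c τ i i₀ hk κ hb hσ ha ha'
      (event (ge 0) (b i.castSucc).2 (w i.succ)) (event (ge 1) (w i.succ) (t i.castSucc))
      (event (ge 0) (t i.castSucc) (b i.succ).1) (event (ge 0) (t i.castSucc) (b i.succ).1)
      (endX a₀ (b i.castSucc).1 (w i.castSucc) (z i.castSucc))
      (isFinitary_event _ _ _) (isFinitary_event _ _ _) (isFinitary_event _ _ _) (isFinitary_event _ _ _)
      (isFinitary_endX _ _ _ _) (fun ω K₀ hF => ?_) ?_ (hrow₂ _ _ _)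
    · obtain ⟨m0, m1, m3, m4⟩ := hm0 ω K₀ hF
      exact ⟨m0, m1, m3, m4, midSOpen_exit_mem M x b w t z a c τ hF i i₀ hk ha huz hw0⟩
    · refine (junF_midECut_xb_le₄ p M x b w t z a τ i i₀ hk hσ ha ha' _ _ _ _ _ _ _).trans ?_
      rw [hzt, endX, if_neg h0]
      obtain h1 | h2 : a₀ = 1 ∨ a₀ = 2 := by
        fin_cases a₀
        · exact absurd rfl h0
        · exact Or.inl rfl
        · exact Or.inr rfl
      · subst h1
        obtain ⟨κ', hκ'⟩ := (zdGraph_adj_iff_stepVec _ _).1 (hw1 rfl)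
        exact piPerc_cutR_one_le p hb hκ' hwt _
      · subst h2
        exact piPerc_cutR_two_le p hb hwt _

/-- **The corner cut-through cells in the shape of the Sharp cell `(true, 0)`**: term 2 of (5.4),
`δ_{z,t}·A'^{κ,a,a′}(u,w,w′,t)·P^{S,0}(u′−t,u′−t)` (`tgtRegB … (true,0)`), PLUS the residue letter
`X_R = δ_{z,t}·T2♯ = δ_{z,t}·(1−δ_{t,u′})·A'^{κ,a,1}(u,w,w′,t)·P^{S,0}(u′−t,u′−t)` (`blockXR`) — the slot `hR` of the
Sharp dispatch (b2b-lace LEMMAS node N76-X2-D77, leaf T2b) at a middle regular pair.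
[cite: FitznerVanDerHofstad2017, §5.1 (5.4) second term (arXiv:1506.07977v2 p. 48); §6.1 (6.4) (pp. 58–59); App. B (pp. 73, 75); §4.4 (4.64) (p. 42)] -/
theorem nonempty_jPkg_midE_cutR_sharp (i i₀ : Fin (M + 1)) (hk : i₀.succ = i.castSucc) (κ : Fin d × Bool)
    (hb : (b i.castSucc).2 = (b i.castSucc).1 + stepVec κ) (hσ : (τ i).1 = true) (a₀ : Fin 3)
    (ha : a i.castSucc = Sum.inl a₀) {a' : Fin 3} (ha' : a i.succ = Sum.inl a') (h2 : a' = 2)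
    (hty : t i.castSucc ≠ (b i.succ).1) (hzt : z i.castSucc = t i.castSucc)
    (hadj : (zdGraph d).Adj (w i.succ) (t i.castSucc)) :
    Nonempty (JPkg p (jctx M x b w t z a τ i.castSucc) (JFacts M x b w t z a c τ)
      (tgtRegB (Letters.perc d p) κ a₀ a' (b i.castSucc).1 (w i.castSucc) (t i.castSucc) (z i.castSucc) (w i.succ)
          (b i.succ).1 (true, 0) +
        blockXR (Letters.perc d p) κ a₀ a' (b i.castSucc).1 (w i.castSucc) (t i.castSucc) (z i.castSucc) (w i.succ)
          (b i.succ).1)) := by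
  subst h2
  obtain ⟨P⟩ := nonempty_jPkg_midE_cutR p M x b w t z a c τ i i₀ hk κ hb hσ a₀ ha ha' hty hzt hadj
  refine ⟨P.monoTgt (le_of_eq ?_)⟩
  have e2 : blockAiota' (Letters.perc d p) κ a₀ 2 = blockAiota (Letters.perc d p) κ a₀ 2 :=
    blockAiota'_of_ne _ _ fun h => absurd h.2 (by decide)
  have e1 : blockAiota' (Letters.perc d p) κ a₀ 1 = blockAiota (Letters.perc d p) κ a₀ 1 :=
    blockAiota'_of_ne _ _ fun h => absurd h.2 (by decide)
  simp only [blockXR, tgtRegB_true_zero, blockT2Sharp_two, hzt, kd_self, kdc_of_ne hty, one_mul, e2, e1, add_mul]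

end Mid

end Summit.CriticalPhenomena.LaceExpansionHighD.NobleBlocks

end
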